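import Literature.Topology.FourManifolds.PairSaddlePassage
import HarnessLib

/-!
# Rigidity of a boundary map near the traces, and agreement of the level conjugation with the
# saddle pieces

Topic `Literature/Topology/FourManifolds` (support file for the two-field handle-extension
endgame of `stmt-SmoothPoincare4-15190`, after `PairSaddlePassage.lean`).  Everything here is
**proved**; the one new definition is the rigidity predicate.

Griffiths, *Automorphisms of a 3-dimensional handlebody* (1964), §§3–6, extends a boundary map
over a handlebody once it is standard near the meridians; Milnor, *Lectures on the h-cobordism
theorem* (1965), proof of Thm. 3.13, compares two Morse models through the Milnor coordinates.
For a pair of basin settings `P` with saddle data `Q` and a boundary map `χ`, the transport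
`P.transportAB χ` acts on the level `L`; **rigidity of `χ` at the saddle `s` with width `δ`**
(`SaddleData.Rigid`) says that on the `ξ_A`-tops of the exit annulus of `s` — flow-polar
coordinates about the trace sphere of `s` — this transport is the model conjugation:
`transportAB χ (top_A z) = top_B (MC s z)`.  Consequences:

* the level conjugation `conj χ` (the piece `R1` of the extension map, `BasinPairConj.lean`)
  **agrees with the exit transport** of `s` on the overlap of the domains (`conj_eq_LT_refExit`),
  **with the entrance transport** (`conj_eq_LT_refEnt`, through a passage and rigidity at the exit
  point) and **with `MC s` on a small ball** (`conj_eq_MC`);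
* rigidity passes to the swapped data and a left inverse of `χ` (`Rigid.swap`).

## References

* H. B. Griffiths, *Automorphisms of a 3-dimensional handlebody*, Abh. Math. Sem. Univ. Hamburg
  26 (1964), §§3–6. [GriffithsHB1964Handlebody]
* J. Milnor, *Lectures on the h-cobordism theorem* (1965), proofs of Thms. 3.12–3.13, Thm. 4.1
  (PDF pp. 17–22). [MilnorHCobordism1965]
-/

open scoped Manifold ContDiff Topology
open Set Function Filter Metric

noncomputable section

namespace Literature.Topology.FourManifolds

open Cobordism FourManifolds.Flow

universe u

variable {n : ℕ} {W : Type u} [TopologicalSpace W] [T2Space W] [SecondCountableTopology W]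
  [CompactSpace W] [ChartedSpace (EuclideanHalfSpace (n + 1)) W] [IsManifold (𝓡∂ (n + 1)) ∞ W]

namespace BasinPair

namespace SaddleData

variable {g : W → ℝ} {ξA ξB : Π x : W, TangentSpace (𝓡∂ (n + 1)) x} {P : BasinPair g ξA ξB}
  (Q : P.SaddleData)

/-! ### Index bookkeeping -/

/-- `MC` along an equality of saddles. [folklore] -/
theorem MC_congr {s₁ s₂ : SaddlePt n g} (h : s₁ = s₂) (x : W) : Q.MC s₁ x = Q.MC s₂ x := by subst h; rfl

/-- The exit sets along an equality of saddles. [folklore] -/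
theorem Uexit_congr {s₁ s₂ : SaddlePt n g} (h : s₁ = s₂) (δ : ℝ) : Q.Uexit s₁ δ = Q.Uexit s₂ δ := by subst h; rfl

/-- The entrance sets along an equality of saddles. [folklore] -/
theorem Uent_congr {s₁ s₂ : SaddlePt n g} (h : s₁ = s₂) (δ : ℝ) : Q.Uent s₁ δ = Q.Uent s₂ δ := by subst h; rfl

/-- **`MC` carries non-critical points to non-critical points** (inside the `3ε`-ball): the only
critical point in the ball of `DB (σ s)` is `σ s = MC s s`. [folklore] -/
theorem not_isMCriticalPt_MC_of_not {s : SaddlePt n g} {x : W} (hx : x ∈ (Q.DA s).chartBall (3 * Q.ε))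
    (hxc : ¬ IsMCriticalPt (𝓡∂ (n + 1)) g x) : ¬ IsMCriticalPt (𝓡∂ (n + 1)) g (Q.MC s x) := fun hc => by
  have hlev : g (Q.MC s x) = g x := Q.apply_MC hx.1 hx.2.le
  rcases Q.isMCriticalPt_cases hc with h | h
  · -- `MC x = p₀` is impossible: levels in the ball exceed `sph > g p₀`
    have h1 := (Q.apply_mem_Ioo_A s hx.1 hx.2.le).1
    rw [← hlev, h] at h1
    exact lt_irrefl _ (P.A.apply_p₀_lt_sph.trans h1)
  · -- `MC x` is a saddle `s''`, inside the source of `DB (σ s)`: so `s'' = σ s` and `x = s`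
    set s'' : SaddlePt n g := ⟨Q.MC s x, hc, P.A.morseIndex_ne_zero hc (by
      intro hp; have h1 := (Q.apply_mem_Ioo_A s hx.1 hx.2.le).1
      rw [← hlev, hp] at h1; exact lt_irrefl _ (P.A.apply_p₀_lt_sph.trans h1))⟩ with hs''
    have hmem₁ : (s''.1 : W) ∈ (Q.DB s'').chart.source := (Q.DB s'').mem_source
    have hmem₂ : (s''.1 : W) ∈ (Q.DB (Q.σ s)).chart.source := Q.MC_mem_source hx.2.le
    have heq : s'' = Q.σ s := by
      by_contra hne
      exact Set.disjoint_left.1 (Q.disjB s'' (Q.σ s) hne) hmem₁ hmem₂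
    -- hence `MC s x = (σ s).1 = MC s s.1`, and `x = s.1`
    have h2 : Q.MC s x = Q.MC s s.1 := by rw [Q.MC_self]; exact congrArg Subtype.val heq
    have h3 : x = s.1 := by
      have hx' := Q.MCi_MC hx.1 hx.2.le
      have hs' := Q.MCi_MC (s := s) (Q.DA s).mem_source (by rw [(Q.DA s).coord_self, norm_zero]; linarith [Q.ε_pos])
      rw [← hx', h2, hs']
    exact hxc (h3 ▸ s.2.1)

/-- The level `c + ε²` lies in `(c, hi)`. [folklore] -/
theorem c_add_sq_mem_Ioo : Q.c + Q.ε ^ 2 ∈ Ioo Q.c P.A.hi :=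
  ⟨lt_add_of_pos_right _ Q.sq_pos, Q.c_add_sq_lt_hi⟩

/-- A point of the exit annulus meets `L` along `ξ_A`. [folklore] -/
theorem hits_L_of_exit {z : W} (hzℓ : g z = Q.c + Q.ε ^ 2) : Hits P.A.θ g P.A.L z :=
  Q.hits_A_of_mem_Ioo_c_hi (by rw [hzℓ]; exact Q.c_add_sq_mem_Ioo) ⟨Q.c_lt_L, P.A.L_lt_hi⟩

/-! ### Rigidity -/

section Rigid

variable [Nonempty (BoundaryManifold.boundaryData n W).carrier]

/-- **Rigidity of the boundary map `χ` at the saddle `s` with width `δ`**: on the exit annulus of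
`s` (width `δ`, level `c + ε²`), the transport of `χ` on the `ξ_A`-tops is the `ξ_B`-top of the
model conjugation — in flow-polar coordinates about the trace of `s`, `χ` is the model map. [cite: GriffithsHB1964Handlebody, §§3–6] -/
def Rigid (χ : (𝓡∂ (n + 1)).boundary W → (𝓡∂ (n + 1)).boundary W) (s : SaddlePt n g) (δ : ℝ) : Prop :=
  ∀ z ∈ Q.Uexit s δ, g z = Q.c + Q.ε ^ 2 → P.transportAB χ (P.A.top z) = P.B.top (Q.MC s z)

variable {Q}
variable {χ χ' : (𝓡∂ (n + 1)).boundary W → (𝓡∂ (n + 1)).boundary W} {s : SaddlePt n g}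

/-- Rigidity with a width is rigidity with every smaller width. [folklore] -/
theorem Rigid.mono {δ δ' : ℝ} (h : Q.Rigid χ s δ') (hδ : δ ≤ δ') : Q.Rigid χ s δ :=
  fun z hz hzℓ => h z (Uexit_mono hδ hz) hzℓ

/-- **The level conjugation agrees with the exit transport** on the overlap of `A.dom` and the
domain of the exit piece. [cite: GriffithsHB1964Handlebody, §§3–6] [cite: MilnorHCobordism1965, Thm. 4.1 (PDF p. 22)] -/
theorem conj_eq_LT_refExit {δ : ℝ} (hR : Q.Rigid χ s δ) {x : W} (hx₁ : x ∈ P.A.dom) (hx₂ : x ∈ (Q.refExit s δ).dom) :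
    P.conj χ x = (Q.refExit s δ).LT x := by
  set z := (Q.refExit s δ).ref x with hz
  have hzU : z ∈ Q.Uexit s δ := RefData.ref_mem_U hx₂
  have hzℓ : g z = Q.c + Q.ε ^ 2 := RefData.apply_ref hx₂
  -- the tops of `x` and `z` agree
  have htop : P.A.top z = P.A.top x := by
    rw [hz, RefData.ref_def, levelProj_apply]; exact P.A.top_θ hx₁.2.1 _
  -- rigidity at `z`, and the definition of the `B`-top
  have hrig := hR z hzU hzℓ
  rw [BasinPair.conj_def, ← htop, hrig, BasinSetting.top_def, RefData.LT_def]
  have hreg : ¬ IsMCriticalPt (𝓡∂ (n + 1)) g (Q.MC s z) := RefData.not_isMCriticalPt_Φ_ref hx₂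
  exact P.B.levelProj_θ hreg (P.B.apply_mem_slab (by rw [P.hi_eq]; exact hx₂.1.2)) (RefData.hits_Φ_ref hx₂ hx₂.1) _

/-- **The level conjugation agrees with the entrance transport** of width `δ ≤ ε²` on the overlap
of the domains, given rigidity with width `≥ 2δ` (the passage from the entrance reference point
exits through the exit annulus of width `2δ`, where rigidity applies). [cite: GriffithsHB1964Handlebody, §§3–6] [cite: MilnorHCobordism1965, proof of Thm. 3.13, Thm. 4.1] -/
theorem conj_eq_LT_refEnt {δ δR : ℝ} (hR : Q.Rigid χ s δR) (hδ : δ ≤ Q.ε ^ 2) (h2δ : 2 * δ ≤ δR)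
    {x : W} (hx₁ : x ∈ P.A.dom) (hx₃ : x ∈ (Q.refEnt s δ).dom) : P.conj χ x = (Q.refEnt s δ).LT x := by
  set w := (Q.refEnt s δ).ref x with hw
  have hwU : w ∈ Q.Uent s δ := RefData.ref_mem_U hx₃
  have hwℓ : g w = Q.c - Q.ε ^ 2 := RefData.apply_ref hx₃
  -- `w` is off the stable disc, since `x` meets `L`
  have hb : 0 < sqSumGE (Q.DA s).k ((Q.DA s).coord w) := by
    refine lt_of_le_of_ne (sqSumGE_nonneg _ _) fun h0 => ?_
    have hnot := Q.not_hits_of_sqSumGE_eq_zero hwU.1 h0.symm Q.c_lt_L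
    rw [hw, RefData.ref_def, P.A.hits_levelProj_iff] at hnot
    exact hnot hx₁.2.1
  obtain ⟨t, ht0, htℓ, hA, hball, hMC⟩ := Q.exists_exit_of_mem_Uent hδ hwU hwℓ hb
  -- the exit point `θ_A (t, w)` lies in the exit annulus of width `δR`, on the orbit of `x`
  have hzU : P.A.θ (t, w) ∈ Q.Uexit s δR := ⟨(hball t ⟨ht0, le_rfl⟩), hA.trans_le h2δ⟩
  have hwL : Hits P.A.θ g P.A.L w := by
    have h := (P.A.hits_θ_iff (hittingTime P.A.θ g (Q.c - Q.ε ^ 2) x) x P.A.L).2 hx₁.2.1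
    exact h
  have htop : P.A.top (P.A.θ (t, w)) = P.A.top x := by
    rw [P.A.top_θ hwL t]
    show P.A.top (P.A.θ (hittingTime P.A.θ g (Q.c - Q.ε ^ 2) x, x)) = P.A.top x
    exact P.A.top_θ hx₁.2.1 _
  have hrig := hR _ hzU htℓ
  rw [BasinPair.conj_def, ← htop, hrig, BasinSetting.top_def, hMC, P.B.θ_add, RefData.LT_def]
  have hreg : ¬ IsMCriticalPt (𝓡∂ (n + 1)) g (Q.MC s w) := RefData.not_isMCriticalPt_Φ_ref hx₃
  exact P.B.levelProj_θ hreg (P.B.apply_mem_slab (by rw [P.hi_eq]; exact hx₃.1.2.trans Q.c_lt_hi))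
    (RefData.hits_Φ_ref hx₃ hx₃.1) _

/-- **The level conjugation agrees with `MC s` on the `ρ`-ball** (`ρ ≤ ε`, `ρ⁴ < 4ε² δR`), given
rigidity of width `δR`: the exit point of a point of the ball lies in the exit annulus of width
`ρ⁴/(4ε²)`. [cite: GriffithsHB1964Handlebody, §§3–6] [cite: MilnorHCobordism1965, proof of Thm. 3.13, Thm. 4.1] -/
theorem conj_eq_MC {δR ρ : ℝ} (hR : Q.Rigid χ s δR) (hρ : ρ ≤ Q.ε) (hρ4 : ρ ^ 4 < 4 * Q.ε ^ 2 * δR)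
    {x : W} (hx₁ : x ∈ P.A.dom) (hxb : x ∈ (Q.DA s).chartBall ρ) : P.conj χ x = Q.MC s x := by
  have hx3 : x ∈ (Q.DA s).chartBall (3 * Q.ε) := ⟨hxb.1, by linarith [hxb.2, Q.ε_pos]⟩
  have hxc : ¬ IsMCriticalPt (𝓡∂ (n + 1)) g x :=
    P.A.not_isMCriticalPt_of_mem_basin (BasinSetting.mem_basin_of_mem_dom hx₁) (BasinSetting.ne_p₀_of_mem_dom hx₁) hx₁.1.le
  -- `x` is off the stable disc, since it meets `L`
  have hb : 0 < sqSumGE (Q.DA s).k ((Q.DA s).coord x) := by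
    refine lt_of_le_of_ne (sqSumGE_nonneg _ _) fun h0 => ?_
    exact Q.not_hits_of_sqSumGE_eq_zero hx3 h0.symm Q.c_lt_L hx₁.2.1
  obtain ⟨t, ht0, htℓ, hA, hball, hMC⟩ := Q.exists_exit_of_mem_chartBall hρ hxb hb
  have hzU : P.A.θ (t, x) ∈ Q.Uexit s δR := by
    refine ⟨hball t ⟨ht0, le_rfl⟩, hA.trans_lt ?_⟩
    rw [div_lt_iff₀ (by linarith [pow_pos Q.ε_pos 2])]; linarith
  have htop : P.A.top (P.A.θ (t, x)) = P.A.top x := P.A.top_θ hx₁.2.1 t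
  have hrig := hR _ hzU htℓ
  rw [BasinPair.conj_def, ← htop, hrig, BasinSetting.top_def, hMC, P.B.θ_add]
  have hreg : ¬ IsMCriticalPt (𝓡∂ (n + 1)) g (Q.MC s x) := Q.not_isMCriticalPt_MC_of_not hx3 hxc
  have hgx : g (Q.MC s x) = g x := Q.apply_MC hx3.1 hx3.2.le
  have hslab : g x ∈ Icc P.B.lo P.B.hi := P.B.apply_mem_slab (by rw [P.hi_eq]; exact hx₁.1)
  rw [P.B.levelProj_θ hreg hslab (hits_of_apply_eq (P.B.θ_zero _) hgx) _]
  exact P.B.levelProj_eq_self hreg hslab hgx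

/-- **Rigidity passes to the swapped data and a left inverse of `χ`** (apply the inverse
transport; `MC` of the swapped data is `MCi`). [folklore] -/
theorem Rigid.swap {δ : ℝ} (hR : Q.Rigid χ s δ) (hχ' : LeftInverse χ' χ) : Q.swap.Rigid χ' (Q.σ s) δ := by
  intro z' hz' hz'ℓ
  set z := Q.swap.MC (Q.σ s) z' with hz
  have hzU : z ∈ Q.Uexit s δ := by
    have h' : z ∈ Q.Uexit (Q.σ.symm (Q.σ s)) δ := Q.swap.MC_mem_Uexit_swap hz'
    rwa [Q.Uexit_congr (Q.σ.symm_apply_apply s)] at h'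
  have hzℓ : g z = Q.c + Q.ε ^ 2 := by rw [hz, Q.swap.apply_MC hz'.1.1 hz'.1.2.le]; exact hz'ℓ
  have hrig := hR z hzU hzℓ
  have hMCz : Q.MC s z = z' := by
    rw [Q.MC_congr (Q.σ.symm_apply_apply s).symm]
    exact Q.MC_MCi hz'.1.1 hz'.1.2.le
  have h1 := congrArg (P.swap.transportAB χ') hrig
  rw [P.transportBA_transportAB hχ' (P.A.apply_top (Q.hits_L_of_exit hzℓ)), hMCz] at h1
  exact h1.symm

end Rigid

end SaddleData

end BasinPair

end Literature.Topology.FourManifolds
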